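import Summits.AtomisticToContinuum.HydrodynamicLimit.Theorems.OneFlightGossipEngineEquilibriumStressVarianceDecayGreenKubo
import Summits.AtomisticToContinuum.HydrodynamicLimit.Theorems.OneFlightGossipEngineEquilibriumStressVarianceDecayCore
import Summits.AtomisticToContinuum.HydrodynamicLimit.Theses.OneFlightGossipEngine

/-!
# `EquilibriumStressVarianceDecay` ⟺ Fejér-mean decay of the `N`-uniform stress autocorrelation; reduction
# to Cesàro decay of `|C_N|` (helper file for stmt-AtomisticToContinuum-9531, route OneFlightGossipEngine)

Frame of the item `OneFlightGossipEngine.EquilibriumStressVarianceDecay` (stmt-9531): homogeneous Gibbs law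
`G_N = localGibbsLaw σ a₀ 0 θ₀ N Φ` (`a₀, θ₀ > 0`, `σ ≤ 1/2`: a probability measure invariant under the flow), a
hard-sphere flow `Φ`, a continuous weight `φ` on `𝕋³`, the per-particle empirical kinetic shear stress
`𝐒[N, φ, z] = (N+1)⁻¹ Σᵢ φ(xᵢ) vᵢ⁰vᵢ¹` (scoped notation, no new constant), its stationary autocorrelation
`C_N(t) = ∫ 𝐒[N,φ,z] 𝐒[N,φ,Φ_t z] dG_N`, and the kinetic window `w = τ (N+1)^{-1/3}`.

* `memLp_two_stress` — `𝐒 ∈ L²(G_N)` (Gaussian velocity marginal; `…Statics`);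
* `ae_item_integrand_eq` — the item's integrand `(N+1)⁻¹ Σᵢ w⁻¹∫₀ʷ φ(xᵢ(r)) vᵢ⁰(r)vᵢ¹(r) dr` IS the window
  average `w⁻¹∫₀ʷ 𝐒[N,φ,Φ_r z] dr` for `G_N`-a.e. `z` (integrable sections);
* `item_term_eq_fejer` — **GREEN–KUBO / FEJÉR FORM OF THE ITEM'S FUNCTIONAL** (every `N`, flow, window):
  `(N+1)·∫⁻ ofReal(Ȳ_w²) dG_N = ofReal((N+1) · 2w⁻² ∫₀ʷ (w − t) C_N(t) dt)` (file `…GreenKubo`);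
* `item_term_le_cesaro_abs_corr` — `… ≤ 2 (N+1) · ofReal(w⁻¹ ∫₀ʷ |C_N(t)| dt)`;
* `equilibriumStressVarianceDecay_iff_fejer_corr_decay` — **THE ITEM IS EQUIVALENT TO**
  `lim_{τ→∞} limsup_N (N+1) · 2w⁻² ∫₀ʷ (w − t) C_N(t) dt = 0` (Fejér/Cesàro-null `N`-uniform stress
  autocorrelation on kinetic times: the exact Green–Kubo reading of item 9531);
* `equilibriumStressVarianceDecay_of_cesaro_corr_decay` — **THE ITEM FOLLOWS FROM**
  `lim_{τ→∞} limsup_N (N+1) · w⁻¹ ∫₀ʷ |C_N(t)| dt = 0`, the docking point of the route's engine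
  (`Cov(stress(0), stress(t)) ≤ …` from the gossip closure, thesis ENGINE; twin of
  `OneFlightGossipEngineHeatFlux.equilibriumHeatFluxVarianceDecay_of_cesaro_corr_decay` for the heat flux).

The hypothesis of the last theorem and both sides of the equivalence are open (N-uniform decay of equilibrium time
correlations of deterministic hard spheres at fixed small density; in print only at Boltzmann–Grad scaling,
Bodineau–Gallagher–Saint-Raymond–Simonella, CPAM 2023); nothing here is claimed beyond the exact bookkeeping.
References: H. Spohn, *Large Scale Dynamics of Interacting Particles* (1991), Part II §1.7; module docstrings of
`…EquilibriumStressVarianceDecayGreenKubo` and `Theorems/BoltzmannGreenKubo/Negative/WindowCovariance.lean`.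
-/

noncomputable section

namespace Summit.AtomisticToContinuum.HydrodynamicLimit.Theorems

open MeasureTheory ProbabilityTheory Filter Topology Set
open Literature.Analysis.FluidPDE Literature.MathematicalPhysics.KineticTheory
open scoped InnerProductSpace ENNReal
open BoltzmannGreenKuboOrthMomentum BoltzmannGreenKuboForallN

namespace EquilibriumStressVarianceDecayC3

/-- Notation (no new constant): the per-particle empirical kinetic shear stress of `N + 1` particles tested
against `φ`, `𝐒[N, φ, z] = (N+1)⁻¹ Σᵢ φ(xᵢ) vᵢ⁰ vᵢ¹` — literally the summand structure of item 9531. -/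
scoped notation "𝐒[" N ", " φ ", " z "]" =>
  (((N : ℝ) + 1)⁻¹ * ∑ i : Fin (N + 1), φ (Prod.fst (z i)) * (Prod.snd (z i) 0 * Prod.snd (z i) 1))

section StressObservable

variable {σ : ℝ} {N : ℕ}

/-- The shear germ `v ↦ v⁰v¹` is measurable on `ℝ³`. [folklore] -/
theorem measurable_coordProd : Measurable fun v : V3 => v 0 * v 1 := by fun_prop

/-- `(w⁰w¹)² ≤ ‖w‖⁴` on `ℝ³`. [folklore] -/
theorem coordProd_sq_le (w : V3) : (w 0 * w 1) ^ 2 ≤ ‖w‖ ^ 4 := by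
  have h1 := abs_coord_mul_coord_le w
  have h2 : (w 0 * w 1) ^ 2 ≤ (‖w‖ ^ 2 / 2) ^ 2 := by
    rw [← sq_abs]; exact pow_le_pow_left₀ (abs_nonneg _) h1 2
  nlinarith [sq_nonneg (‖w‖ ^ 2)]

/-- **The shear germ is square integrable under the standard Gaussian** `γ` on `ℝ³` (Gaussian fourth moment).
[folklore] -/
theorem memLp_two_coordProd_stdGaussian : MemLp (fun w : V3 => w 0 * w 1) 2 (stdGaussian V3) := by
  have hgsc : Continuous fun w : V3 => w 0 * w 1 := by fun_prop
  rw [memLp_two_iff_integrable_sq hgsc.aestronglyMeasurable]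
  refine integrable_norm_pow_four_stdGaussian.mono' (hgsc.measurable.pow_const 2).aestronglyMeasurable
    (Eventually.of_forall fun w => ?_)
  rw [Real.norm_eq_abs, abs_of_nonneg (sq_nonneg _)]
  exact coordProd_sq_le w

/-- The shear germ is centred under `γ` (odd under `w⁰ ↦ −w⁰`). [folklore] -/
theorem integral_coordProd_stdGaussian : ∫ w : V3, w 0 * w 1 ∂stdGaussian V3 = 0 :=
  integral_stdGaussian_eq_zero_of_odd (reflB 0) (G := fun w : V3 => w 0 * w 1) shear_reflB_zero

/-- `∫ (w⁰w¹)² dγ ≤ E_γ‖w‖⁴`. [folklore] -/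
theorem integral_coordProd_sq_stdGaussian_le :
    ∫ w : V3, (w 0 * w 1) ^ 2 ∂stdGaussian V3 ≤ ∫ w : V3, ‖w‖ ^ 4 ∂stdGaussian V3 :=
  integral_mono memLp_two_coordProd_stdGaussian.integrable_sq integrable_norm_pow_four_stdGaussian coordProd_sq_le

/-- Standardisation of the shear germ: `v⁰v¹ = θ · ((v−0)/√θ)⁰((v−0)/√θ)¹` for `θ > 0`. [folklore] -/
theorem coordProd_eq_theta_mul {θ : ℝ} (hθ : 0 < θ) (v : V3) :
    v 0 * v 1 = θ * (((Real.sqrt θ)⁻¹ • (v - 0)) 0 * ((Real.sqrt θ)⁻¹ • (v - 0)) 1) := by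
  simp only [sub_zero, PiLp.smul_apply, smul_eq_mul]
  rw [show (Real.sqrt θ)⁻¹ * v 0 * ((Real.sqrt θ)⁻¹ * v 1) = (Real.sqrt θ ^ 2)⁻¹ * (v 0 * v 1) by ring,
    Real.sq_sqrt hθ.le]
  field_simp

/-- **The shear germ is square integrable under `N(0, θ)`**: `v ↦ v⁰v¹ ∈ L²(gaussMeasure 0 θ)`
(standardisation `v = √θ w`). [folklore] -/
theorem memLp_two_coordProd_gaussMeasure {θ : ℝ} (hθ : 0 < θ) :
    MemLp (fun v : V3 => v 0 * v 1) 2 (gaussMeasure (0 : V3) θ) := by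
  have hgsc : Continuous fun w : V3 => w 0 * w 1 := by fun_prop
  have hst := (standardize_gaussMeasure hθ (0 : V3) hgsc.measurable).2 memLp_two_coordProd_stdGaussian
  have heq : (fun v : V3 => v 0 * v 1) =
      fun v => θ * (((Real.sqrt θ)⁻¹ • (v - 0)) 0 * ((Real.sqrt θ)⁻¹ • (v - 0)) 1) :=
    funext fun v => coordProd_eq_theta_mul hθ v
  rw [heq]
  exact hst.const_mul θ

/-- **Static second moment of `𝐒`**: `∫⁻ ofReal(𝐒²) dG_N ≤ ofReal((N+1)⁻¹ θ² K² E_γ‖w‖⁴)` (conditionally on the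
positions the velocities are i.i.d. `N(0, θ)` and the germ is centred: weighted statics of `…Statics`). [folklore] -/
theorem lintegral_stress_sq_le {c θ : ℝ} (hc : 0 ≤ c) (hθ : 0 < θ)
    (Φ : HardSphereFlow (Torus.geometry (Fin 3)) (hsDiameter σ N) (N + 1))
    [IsProbabilityMeasure (localGibbsLaw σ (fun _ => c) (fun _ => 0) (fun _ => θ) N Φ)]
    {φ : T3 → ℝ} (hφ : Continuous φ) {K : ℝ} (hK : ∀ x, |φ x| ≤ K) :
    ∫⁻ z, ENNReal.ofReal (𝐒[N, φ, z] ^ 2) ∂(localGibbsLaw σ (fun _ => c) (fun _ => 0) (fun _ => θ) N Φ) ≤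
      ENNReal.ofReal (((N : ℝ) + 1)⁻¹ * (θ ^ 2 * (K ^ 2 * ∫ w : V3, ‖w‖ ^ 4 ∂stdGaussian V3))) := by
  set G := localGibbsLaw σ (fun _ => c) (fun _ => 0) (fun _ => θ) N Φ with hGdef
  have hNpos : (0 : ℝ) < (N : ℝ) + 1 := by positivity
  have hN0 : (N : ℝ) + 1 ≠ 0 := hNpos.ne'
  have hgsc : Continuous fun w : V3 => w 0 * w 1 := by fun_prop
  have e : ∀ z : Config (N + 1) (Fin 3) T3, 𝐒[N, φ, z] = (((N : ℝ) + 1)⁻¹ * θ) * ∑ i : Fin (N + 1), φ (z i).1 *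
      (((Real.sqrt θ)⁻¹ • ((z i).2 - 0)) 0 * ((Real.sqrt θ)⁻¹ • ((z i).2 - 0)) 1) := by
    intro z
    simp only [mul_assoc, Finset.mul_sum]
    refine Finset.sum_congr rfl fun i _ => ?_
    rw [coordProd_eq_theta_mul hθ (z i).2]
    ring
  have hS := lintegral_sq_sum_weighted_le hc hθ 0 Φ hgsc.measurable memLp_two_coordProd_stdGaussian
    integral_coordProd_stdGaussian hφ hK
  have hpt : ∀ z : Config (N + 1) (Fin 3) T3, ENNReal.ofReal (𝐒[N, φ, z] ^ 2) =
      ENNReal.ofReal ((((N : ℝ) + 1)⁻¹ * θ) ^ 2) * ENNReal.ofReal ((∑ i : Fin (N + 1), φ (z i).1 *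
        (((Real.sqrt θ)⁻¹ • ((z i).2 - 0)) 0 * ((Real.sqrt θ)⁻¹ • ((z i).2 - 0)) 1)) ^ 2) := by
    intro z
    rw [e z, mul_pow, ENNReal.ofReal_mul (sq_nonneg _)]
  simp_rw [hpt]
  rw [lintegral_const_mul' _ _ ENNReal.ofReal_ne_top]
  calc ENNReal.ofReal ((((N : ℝ) + 1)⁻¹ * θ) ^ 2) * ∫⁻ z, ENNReal.ofReal ((∑ i : Fin (N + 1), φ (z i).1 *
          (((Real.sqrt θ)⁻¹ • ((z i).2 - 0)) 0 * ((Real.sqrt θ)⁻¹ • ((z i).2 - 0)) 1)) ^ 2) ∂G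
      ≤ ENNReal.ofReal ((((N : ℝ) + 1)⁻¹ * θ) ^ 2) *
          ENNReal.ofReal (((N : ℝ) + 1) * (K ^ 2 * ∫ w : V3, (w 0 * w 1) ^ 2 ∂stdGaussian V3)) :=
        mul_le_mul' le_rfl hS
    _ ≤ ENNReal.ofReal ((((N : ℝ) + 1)⁻¹ * θ) ^ 2) *
          ENNReal.ofReal (((N : ℝ) + 1) * (K ^ 2 * ∫ w : V3, ‖w‖ ^ 4 ∂stdGaussian V3)) := by
        exact mul_le_mul' le_rfl (ENNReal.ofReal_le_ofReal (mul_le_mul_of_nonneg_left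
          (mul_le_mul_of_nonneg_left integral_coordProd_sq_stdGaussian_le (sq_nonneg _)) hNpos.le))
    _ = ENNReal.ofReal (((N : ℝ) + 1)⁻¹ * (θ ^ 2 * (K ^ 2 * ∫ w : V3, ‖w‖ ^ 4 ∂stdGaussian V3))) := by
        rw [← ENNReal.ofReal_mul (sq_nonneg _)]
        congr 1
        field_simp

/-- `z ↦ 𝐒[N, φ, z]` is measurable for continuous `φ`. [folklore] -/
theorem measurable_stress {φ : T3 → ℝ} (hφ : Continuous φ) :
    Measurable fun z : Config (N + 1) (Fin 3) T3 => 𝐒[N, φ, z] := by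
  refine (Finset.measurable_sum _ fun i _ => ?_).const_mul _
  exact (hφ.measurable.comp (measurable_pi_apply i).fst).mul (measurable_coordProd.comp (measurable_pi_apply i).snd)

/-- **`𝐒 ∈ L²(G_N)`** under the homogeneous Gibbs law (`c ≥ 0`, `θ > 0`, a probability measure), for
continuous `|φ| ≤ K`. [folklore] -/
theorem memLp_two_stress {c θ : ℝ} (hc : 0 ≤ c) (hθ : 0 < θ)
    (Φ : HardSphereFlow (Torus.geometry (Fin 3)) (hsDiameter σ N) (N + 1))
    [IsProbabilityMeasure (localGibbsLaw σ (fun _ => c) (fun _ => 0) (fun _ => θ) N Φ)]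
    {φ : T3 → ℝ} (hφ : Continuous φ) {K : ℝ} (hK : ∀ x, |φ x| ≤ K) :
    MemLp (fun z : Config (N + 1) (Fin 3) T3 => 𝐒[N, φ, z]) 2
      (localGibbsLaw σ (fun _ => c) (fun _ => 0) (fun _ => θ) N Φ) :=
  (memLp_finsetSum _ fun i _ => memLp_weighted hc hθ 0 Φ measurable_coordProd
    (memLp_two_coordProd_gaussMeasure hθ) hφ hK i).const_mul _

/-- **The item's integrand is the window average of `𝐒`**, `G_N`-almost everywhere: for `h > 0`,
`(N+1)⁻¹ Σᵢ h⁻¹∫₀ʰ φ(xᵢ(r)) vᵢ⁰(r) vᵢ¹(r) dr = h⁻¹ ∫₀ʰ 𝐒[N, φ, Φ_r z] dr` (the finite sum and the time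
integral commute along every orbit with integrable sections, which is a.e. every orbit). [folklore] -/
theorem ae_item_integrand_eq {c θ : ℝ} (hc : 0 ≤ c) (hθ : 0 < θ)
    (Φ : HardSphereFlow (Torus.geometry (Fin 3)) (hsDiameter σ N) (N + 1))
    [IsProbabilityMeasure (localGibbsLaw σ (fun _ => c) (fun _ => 0) (fun _ => θ) N Φ)]
    {φ : T3 → ℝ} (hφ : Continuous φ) {K : ℝ} (hK : ∀ x, |φ x| ≤ K) {h : ℝ} (hh : 0 < h) :
    ∀ᵐ z ∂(localGibbsLaw σ (fun _ => c) (fun _ => 0) (fun _ => θ) N Φ),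
      (((N : ℝ) + 1)⁻¹ * ∑ i : Fin (N + 1),
        (h⁻¹ * ∫ r in (0 : ℝ)..h, φ ((Φ.flow r z i).1) * ((Φ.flow r z i).2 0 * (Φ.flow r z i).2 1))) =
      h⁻¹ * ∫ r in (0 : ℝ)..h, 𝐒[N, φ, Φ.flow r z] := by
  set G := localGibbsLaw σ (fun _ => c) (fun _ => 0) (fun _ => θ) N Φ with hGdef
  set Y0 : V3 → ℝ := fun v => v 0 * v 1 with hY0
  set Xi : Fin (N + 1) → Config (N + 1) (Fin 3) T3 → ℝ := fun i w => φ (w i).1 * Y0 (w i).2 with hXi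
  have hY0m : Measurable Y0 := by rw [hY0]; fun_prop
  have hY02 : MemLp Y0 2 (gaussMeasure 0 θ) := memLp_two_coordProd_gaussMeasure hθ
  have hXi2 : ∀ i, MemLp (Xi i) 2 G := fun i => memLp_weighted hc hθ 0 Φ hY0m hY02 hφ hK i
  have hXim : ∀ i, Measurable (Xi i) := fun i =>
    (hφ.measurable.comp (measurable_pi_apply i).fst).mul (hY0m.comp (measurable_pi_apply i).snd)
  have hseci : ∀ᵐ z ∂G, ∀ i, IntegrableOn (fun r => Xi i (Φ.flow r z)) (Ioc (0 : ℝ) h) := by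
    rw [ae_all_iff]
    exact fun i => (integrable_comp_flow_prod c θ 0 Φ (hXim i) ((hXi2 i).integrable one_le_two) h).prod_left_ae
  filter_upwards [hseci] with z hzi
  have hii : ∀ i ∈ (Finset.univ : Finset (Fin (N + 1))), IntervalIntegrable (fun r => Xi i (Φ.flow r z)) volume 0 h :=
    fun i _ => (intervalIntegrable_iff_integrableOn_Ioc_of_le hh.le).2 (hzi i)
  have e1 : ∑ i : Fin (N + 1), (h⁻¹ * ∫ r in (0 : ℝ)..h, φ ((Φ.flow r z i).1) * ((Φ.flow r z i).2 0 * (Φ.flow r z i).2 1)) =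
      h⁻¹ * ∫ r in (0 : ℝ)..h, ∑ i : Fin (N + 1), Xi i (Φ.flow r z) := by
    rw [← Finset.mul_sum, ← intervalIntegral.integral_finsetSum hii]
  have e2 : (fun r => 𝐒[N, φ, Φ.flow r z]) = fun r => ((N : ℝ) + 1)⁻¹ * ∑ i : Fin (N + 1), Xi i (Φ.flow r z) := by
    funext r; rfl
  rw [e1, e2, intervalIntegral.integral_const_mul]
  ring

end StressObservable

section ItemTerm

variable {σ : ℝ} {N : ℕ}

/-- **GREEN–KUBO / FEJÉR FORM OF THE ITEM'S FUNCTIONAL** (every `N`, every flow, every window `h > 0`, the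
homogeneous Gibbs law a probability measure): `(N+1) · ∫⁻ ofReal(((N+1)⁻¹ Σᵢ h⁻¹∫₀ʰ φ(xᵢ(r)) vᵢ⁰(r)vᵢ¹(r) dr)²) dG_N
= ofReal((N+1) · 2h⁻² ∫₀ʰ (h − t) C_N(t) dt)` with `C_N(t) = ∫ 𝐒[N,φ,z] 𝐒[N,φ,Φ_t z] dG_N`. [folklore] -/
theorem item_term_eq_fejer {c θ : ℝ} (hc : 0 ≤ c) (hθ : 0 < θ)
    (Φ : HardSphereFlow (Torus.geometry (Fin 3)) (hsDiameter σ N) (N + 1))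
    [IsProbabilityMeasure (localGibbsLaw σ (fun _ => c) (fun _ => 0) (fun _ => θ) N Φ)]
    {φ : T3 → ℝ} (hφ : Continuous φ) {K : ℝ} (hK : ∀ x, |φ x| ≤ K) {h : ℝ} (hh : 0 < h) :
    ((N : ℝ≥0∞) + 1) * ∫⁻ z, ENNReal.ofReal ((((N : ℝ) + 1)⁻¹ * ∑ i : Fin (N + 1),
        (h⁻¹ * ∫ r in (0 : ℝ)..h, φ ((Φ.flow r z i).1) * ((Φ.flow r z i).2 0 * (Φ.flow r z i).2 1))) ^ 2)
        ∂(localGibbsLaw σ (fun _ => c) (fun _ => 0) (fun _ => θ) N Φ) =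
      ENNReal.ofReal (((N : ℝ) + 1) * (2 * h⁻¹ ^ 2 * ∫ t in (0 : ℝ)..h, (h - t) *
        ∫ z, 𝐒[N, φ, z] * 𝐒[N, φ, Φ.flow t z] ∂(localGibbsLaw σ (fun _ => c) (fun _ => 0) (fun _ => θ) N Φ))) := by
  set G := localGibbsLaw σ (fun _ => c) (fun _ => 0) (fun _ => θ) N Φ with hGdef
  have e : ∫⁻ z, ENNReal.ofReal ((((N : ℝ) + 1)⁻¹ * ∑ i : Fin (N + 1),
        (h⁻¹ * ∫ r in (0 : ℝ)..h, φ ((Φ.flow r z i).1) * ((Φ.flow r z i).2 0 * (Φ.flow r z i).2 1))) ^ 2) ∂G =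
      ∫⁻ z, ENNReal.ofReal ((h⁻¹ * ∫ r in (0 : ℝ)..h, 𝐒[N, φ, Φ.flow r z]) ^ 2) ∂G := by
    refine lintegral_congr_ae ?_
    filter_upwards [ae_item_integrand_eq hc hθ Φ hφ hK hh] with z hz
    rw [hz]
  have hcast : ((N : ℝ≥0∞) + 1) = ENNReal.ofReal ((N : ℝ) + 1) := by
    rw [ENNReal.ofReal_add (Nat.cast_nonneg N) zero_le_one, ENNReal.ofReal_natCast, ENNReal.ofReal_one]
  rw [e, lintegral_sq_windowAvg_eq_fejer c θ 0 Φ (measurable_stress hφ) (memLp_two_stress hc hθ Φ hφ hK) hh,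
    hcast, ← ENNReal.ofReal_mul (by positivity)]

/-- **Green–Kubo inequality for the item's functional** (every `N`, flow, window `h > 0`):
`(N+1) · ∫⁻ ofReal(Ȳ_h²) dG_N ≤ 2 · (N+1) · ofReal(h⁻¹ ∫₀ʰ |C_N(t)| dt)`. [folklore] -/
theorem item_term_le_cesaro_abs_corr {c θ : ℝ} (hc : 0 ≤ c) (hθ : 0 < θ)
    (Φ : HardSphereFlow (Torus.geometry (Fin 3)) (hsDiameter σ N) (N + 1))
    [IsProbabilityMeasure (localGibbsLaw σ (fun _ => c) (fun _ => 0) (fun _ => θ) N Φ)]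
    {φ : T3 → ℝ} (hφ : Continuous φ) {K : ℝ} (hK : ∀ x, |φ x| ≤ K) {h : ℝ} (hh : 0 < h) :
    ((N : ℝ≥0∞) + 1) * ∫⁻ z, ENNReal.ofReal ((((N : ℝ) + 1)⁻¹ * ∑ i : Fin (N + 1),
        (h⁻¹ * ∫ r in (0 : ℝ)..h, φ ((Φ.flow r z i).1) * ((Φ.flow r z i).2 0 * (Φ.flow r z i).2 1))) ^ 2)
        ∂(localGibbsLaw σ (fun _ => c) (fun _ => 0) (fun _ => θ) N Φ) ≤
      2 * (((N : ℝ≥0∞) + 1) * ENNReal.ofReal (h⁻¹ * ∫ t in (0 : ℝ)..h,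
        |∫ z, 𝐒[N, φ, z] * 𝐒[N, φ, Φ.flow t z] ∂(localGibbsLaw σ (fun _ => c) (fun _ => 0) (fun _ => θ) N Φ)|)) := by
  set G := localGibbsLaw σ (fun _ => c) (fun _ => 0) (fun _ => θ) N Φ with hGdef
  have e : ∫⁻ z, ENNReal.ofReal ((((N : ℝ) + 1)⁻¹ * ∑ i : Fin (N + 1),
        (h⁻¹ * ∫ r in (0 : ℝ)..h, φ ((Φ.flow r z i).1) * ((Φ.flow r z i).2 0 * (Φ.flow r z i).2 1))) ^ 2) ∂G =
      ∫⁻ z, ENNReal.ofReal ((h⁻¹ * ∫ r in (0 : ℝ)..h, 𝐒[N, φ, Φ.flow r z]) ^ 2) ∂G := by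
    refine lintegral_congr_ae ?_
    filter_upwards [ae_item_integrand_eq hc hθ Φ hφ hK hh] with z hz
    rw [hz]
  have hstep := lintegral_sq_windowAvg_le_cesaro_abs_corr c θ 0 Φ (measurable_stress hφ) (memLp_two_stress hc hθ Φ hφ hK) hh
  rw [mul_assoc, ← two_mul_ofReal] at hstep
  rw [e]
  calc ((N : ℝ≥0∞) + 1) * ∫⁻ z, ENNReal.ofReal ((h⁻¹ * ∫ r in (0 : ℝ)..h, 𝐒[N, φ, Φ.flow r z]) ^ 2) ∂G
      ≤ ((N : ℝ≥0∞) + 1) * (2 * ENNReal.ofReal (h⁻¹ * ∫ t in (0 : ℝ)..h, |∫ z, 𝐒[N, φ, z] * 𝐒[N, φ, Φ.flow t z] ∂G|)) :=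
        mul_le_mul_right hstep _
    _ = _ := by ring

/-- Kinetic windows are positive for positive `τ`. [folklore] -/
theorem kineticWindow_pos {τ : ℝ} (hτ : 0 < τ) (N : ℕ) : 0 < τ * ((N : ℝ) + 1) ^ (-(1 / 3 : ℝ)) :=
  mul_pos hτ (Real.rpow_pos_of_pos (by positivity) _)

end ItemTerm

end EquilibriumStressVarianceDecayC3

open EquilibriumStressVarianceDecayC3

/-- **`EquilibriumStressVarianceDecay` IS EQUIVALENT TO THE FEJÉR-MEAN DECAY OF THE `N`-UNIFORM STRESS
AUTOCORRELATION** (the exact Green–Kubo reading of item stmt-9531): for all `a₀, θ₀ > 0` there is `σ₀ > 0` such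
that for `0 < σ < σ₀`, every flow family `Φ_N` and every continuous `φ`,
`lim_{τ→∞} limsup_N (N+1) · 2w_N⁻² ∫₀^{w_N} (w_N − t) C_N(t) dt = 0`, `w_N = τ(N+1)^{-1/3}`,
`C_N(t) = E_{λ^N}[𝐒 · 𝐒∘Φ^N_t]`, `𝐒 = (N+1)⁻¹ Σᵢ φ(xᵢ) vᵢ⁰vᵢ¹`. Both directions shrink `σ₀` below `1/2` (where
the homogeneous Gibbs law is a probability measure) and rewrite the item's functional window by window with
`item_term_eq_fejer`. [folklore] -/
theorem equilibriumStressVarianceDecay_iff_fejer_corr_decay :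
    Summit.AtomisticToContinuum.HydrodynamicLimit.Theses.OneFlightGossipEngine.EquilibriumStressVarianceDecay ↔
    ∀ (a₀ θ₀ : ℝ), 0 < a₀ → 0 < θ₀ → ∃ σ₀ : ℝ, 0 < σ₀ ∧ ∀ σ : ℝ, 0 < σ → σ < σ₀ →
      ∀ Φ : (N : ℕ) → HardSphereFlow (Torus.geometry (Fin 3)) (hsDiameter σ N) (N + 1),
      ∀ φ : T3 → ℝ, Continuous φ →
        Tendsto (fun τ : ℝ => Filter.limsup (fun N : ℕ => ENNReal.ofReal (((N : ℝ) + 1) *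
          (2 * (τ * ((N : ℝ) + 1) ^ (-(1 / 3 : ℝ)))⁻¹ ^ 2 *
            ∫ t in (0 : ℝ)..(τ * ((N : ℝ) + 1) ^ (-(1 / 3 : ℝ))), (τ * ((N : ℝ) + 1) ^ (-(1 / 3 : ℝ)) - t) *
              ∫ z, 𝐒[N, φ, z] * 𝐒[N, φ, (Φ N).flow t z]
                ∂(localGibbsLaw σ (fun _ => a₀) (fun _ => 0) (fun _ => θ₀) N (Φ N))))) atTop) atTop (𝓝 0) := by
  constructor
  · intro hS a₀ θ₀ ha hθ
    obtain ⟨σ₀, hσ₀, hH⟩ := hS a₀ θ₀ ha hθ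
    refine ⟨min σ₀ (1 / 2), lt_min hσ₀ (by norm_num), fun σ hσ hσlt Φ φ hφ => ?_⟩
    have hσ₀' : σ < σ₀ := lt_of_lt_of_le hσlt (min_le_left _ _)
    have hσhalf : σ ≤ 1 / 2 := (lt_of_lt_of_le hσlt (min_le_right _ _)).le
    obtain ⟨K, -, hK⟩ := exists_forall_abs_le_of_continuous hφ
    refine (hH σ hσ hσ₀' Φ φ hφ).congr' ?_
    filter_upwards [eventually_gt_atTop (0 : ℝ)] with τ hτ
    refine congr_arg (fun f : ℕ → ℝ≥0∞ => Filter.limsup f atTop) (funext fun N => ?_)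
    haveI : IsProbabilityMeasure (localGibbsLaw σ (fun _ => a₀) (fun _ => (0 : V3)) (fun _ => θ₀) N (Φ N)) :=
      isProbabilityMeasure_localGibbsLaw continuous_const continuous_const continuous_const
        (fun _ => ha) (fun _ => hθ) hσhalf N (Φ N)
    exact item_term_eq_fejer ha.le hθ (Φ N) hφ hK (kineticWindow_pos hτ N)
  · intro hF a₀ θ₀ ha hθ
    obtain ⟨σ₀, hσ₀, hH⟩ := hF a₀ θ₀ ha hθ
    refine ⟨min σ₀ (1 / 2), lt_min hσ₀ (by norm_num), fun σ hσ hσlt Φ φ hφ => ?_⟩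
    have hσ₀' : σ < σ₀ := lt_of_lt_of_le hσlt (min_le_left _ _)
    have hσhalf : σ ≤ 1 / 2 := (lt_of_lt_of_le hσlt (min_le_right _ _)).le
    obtain ⟨K, -, hK⟩ := exists_forall_abs_le_of_continuous hφ
    refine (hH σ hσ hσ₀' Φ φ hφ).congr' ?_
    filter_upwards [eventually_gt_atTop (0 : ℝ)] with τ hτ
    refine congr_arg (fun f : ℕ → ℝ≥0∞ => Filter.limsup f atTop) (funext fun N => ?_)
    haveI : IsProbabilityMeasure (localGibbsLaw σ (fun _ => a₀) (fun _ => (0 : V3)) (fun _ => θ₀) N (Φ N)) :=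
      isProbabilityMeasure_localGibbsLaw continuous_const continuous_const continuous_const
        (fun _ => ha) (fun _ => hθ) hσhalf N (Φ N)
    exact (item_term_eq_fejer ha.le hθ (Φ N) hφ hK (kineticWindow_pos hτ N)).symm

/-- **`EquilibriumStressVarianceDecay` FOLLOWS FROM THE GREEN–KUBO-TYPE DECAY OF THE EQUILIBRIUM STRESS
AUTOCORRELATION** (the docking point of the route's gossip engine, which bounds `Cov(stress(0), stress(t))`).
Hypothesis (open, in kinetic time units, uniformly in `N`): for all `a₀, θ₀ > 0` there is `σ₀ > 0` such that for
`0 < σ < σ₀`, every flow family and every continuous `φ`,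
`lim_{τ→∞} limsup_N (N+1) · w_N⁻¹ ∫₀^{w_N} |E_{λ^N}[𝐒 · 𝐒∘Φ^N_t]| dt = 0`. Conclusion: the route item, via
`(N+1)E[Ȳ_τ²] ≤ 2(N+1) w_N⁻¹∫₀^{w_N}|C_N|` (`item_term_le_cesaro_abs_corr`). [folklore] -/
theorem equilibriumStressVarianceDecay_of_cesaro_corr_decay
    (H : ∀ (a₀ θ₀ : ℝ), 0 < a₀ → 0 < θ₀ → ∃ σ₀ : ℝ, 0 < σ₀ ∧ ∀ σ : ℝ, 0 < σ → σ < σ₀ →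
      ∀ Φ : (N : ℕ) → HardSphereFlow (Torus.geometry (Fin 3)) (hsDiameter σ N) (N + 1),
      ∀ φ : T3 → ℝ, Continuous φ →
        Tendsto (fun τ : ℝ => Filter.limsup (fun N : ℕ => ((N : ℝ≥0∞) + 1) *
          ENNReal.ofReal ((τ * ((N : ℝ) + 1) ^ (-(1 / 3 : ℝ)))⁻¹ *
            ∫ t in (0 : ℝ)..(τ * ((N : ℝ) + 1) ^ (-(1 / 3 : ℝ))),
              |∫ z, 𝐒[N, φ, z] * 𝐒[N, φ, (Φ N).flow t z]
                ∂(localGibbsLaw σ (fun _ => a₀) (fun _ => 0) (fun _ => θ₀) N (Φ N))|)) atTop) atTop (𝓝 0)) :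
    Summit.AtomisticToContinuum.HydrodynamicLimit.Theses.OneFlightGossipEngine.EquilibriumStressVarianceDecay := by
  intro a₀ θ₀ ha hθ
  obtain ⟨σ₀, hσ₀, hH⟩ := H a₀ θ₀ ha hθ
  refine ⟨min σ₀ (1 / 2), lt_min hσ₀ (by norm_num), fun σ hσ hσlt Φ φ hφ => ?_⟩
  have hσ₀' : σ < σ₀ := lt_of_lt_of_le hσlt (min_le_left _ _)
  have hσhalf : σ ≤ 1 / 2 := (lt_of_lt_of_le hσlt (min_le_right _ _)).le
  obtain ⟨K, -, hK⟩ := exists_forall_abs_le_of_continuous hφ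
  have hD := hH σ hσ hσ₀' Φ φ hφ
  set D : ℝ → ℝ≥0∞ := fun τ => Filter.limsup (fun N : ℕ => ((N : ℝ≥0∞) + 1) *
    ENNReal.ofReal ((τ * ((N : ℝ) + 1) ^ (-(1 / 3 : ℝ)))⁻¹ *
      ∫ t in (0 : ℝ)..(τ * ((N : ℝ) + 1) ^ (-(1 / 3 : ℝ))),
        |∫ z, 𝐒[N, φ, z] * 𝐒[N, φ, (Φ N).flow t z]
          ∂(localGibbsLaw σ (fun _ => a₀) (fun _ => 0) (fun _ => θ₀) N (Φ N))|)) atTop with hDdef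
  have h2D : Tendsto (fun τ => 2 * D τ) atTop (𝓝 0) := by
    have h := ENNReal.Tendsto.const_mul hD (Or.inr ENNReal.ofNat_ne_top) (a := 2)
    rwa [mul_zero] at h
  refine tendsto_of_tendsto_of_tendsto_of_le_of_le' tendsto_const_nhds h2D
    (Eventually.of_forall fun τ => zero_le) ?_
  filter_upwards [eventually_gt_atTop (0 : ℝ)] with τ hτ
  rw [hDdef, ← ENNReal.limsup_const_mul_of_ne_top ENNReal.ofNat_ne_top]
  refine limsup_le_limsup (Eventually.of_forall fun N => ?_)
  haveI : IsProbabilityMeasure (localGibbsLaw σ (fun _ => a₀) (fun _ => (0 : V3)) (fun _ => θ₀) N (Φ N)) :=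
    isProbabilityMeasure_localGibbsLaw continuous_const continuous_const continuous_const
      (fun _ => ha) (fun _ => hθ) hσhalf N (Φ N)
  exact item_term_le_cesaro_abs_corr ha.le hθ (Φ N) hφ hK (kineticWindow_pos hτ N)

end Summit.AtomisticToContinuum.HydrodynamicLimit.Theorems

end
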